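import Literature.Computability.Cryptography.VanDamSeroussiInterference
import Literature.Computability.Cryptography.VanDamSeroussiReference
import Literature.Computability.Cryptography.VanDamSeroussiPhaseGrid
import HarnessLib

/-!
# The interference probabilities of the van Dam–Seroussi circuit

Topic `Literature/Computability/Cryptography`; support for the discharge of
`VanDamSeroussi2002_gaussSumPhase_qsolvable`. van Dam–Seroussi 2002 estimate the unknown phase
`γ` of `G(χ)/√p` against a KNOWN Gauss sum: with a control qubit in `(|0⟩ + |1⟩)/√2` the two branches
end in `e^{iγ₀} ψ` and `e^{iγ₁} ψ` for the SAME state `ψ`, and a Hadamard on the control reads `0`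
with probability `(1 + cos(γ₀ − γ₁))/2` (§3.1 Fact 2), a phase gate `S` before it giving the sine
(§4, proof of Thm. 1: "estimate γ by sampling"). In the tree's realisation the two branch states are
only CLOSE to `λ₀ u`, `λ₁ u` for a common vector `u` (`VanDamSeroussiUnphase.norm_toE_branch_sub_le`),
with `λ₀ = G(χ, e)/√p` and `λ₁ = G(η, e)/√p` (η the quadratic character). This file proves:

* **`abs_probRe_sub_le`**, **`abs_probIm_sub_le`** — for unit vectors `v₀, v₁` within `ε₀, ε₁` of
  `λ₀ u, λ₁ u` (`|λ₀| = |λ₁| = 1`, any `u`): `|‖(v₀ + v₁)/2‖² − (1 + Re(λ₀ λ̄₁))/2|` and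
  `|‖(v₀ + i v₁)/2‖² − (1 + Im(λ₀ λ̄₁))/2|` are at most `δ(2 + δ)`, `δ = (3ε₀ + ε₁)/2`
  (normalise `u`; Fact 2 in the robust form `abs_norm_sq_half_add_sub_le`);
* `norm_branchScalar` (`|G(χ, e)/√p| = 1`), **`branchScalar_quadCharC`** (`G(η, e)/√p = ε_p`, Gauss's
  sign theorem in the tree's `legendreGaussSum_eq`), `gaussSum_mulShift_div_sqrt` (the twisted sum the
  named fact speaks about is `χ⁻¹(b) · G(χ, e)/√p`).

Everything is proved; no definition, no named fact.

## References

* W. van Dam, G. Seroussi, arXiv:quant-ph/0207131 (2002), §3.1 Fact 2, §4 Thm. 1 (proof)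
  [VanDamSeroussi2002].
* K. Ireland, M. Rosen, *A Classical Introduction to Modern Number Theory*, GTM 84, Ch. 6 §4 Thm. 1
  (the sign of the quadratic Gauss sum) [IrelandRosen1990].
-/

noncomputable section

namespace Literature.Computability.Cryptography

namespace VanDamSeroussi

open Complex

/-! ### Two branches close to a common vector -/

section Common

variable {E : Type*} [NormedAddCommGroup E] [NormedSpace ℂ E]

/-- Normalising the common vector: if the unit vector `v₀` is within `ε₀` of `λ₀ u` (`|λ₀| = 1`), then
`u ≠ 0` provided `ε₀ < 1`, and `‖u − u/‖u‖‖ = |‖u‖ − 1| ≤ ε₀`. [folklore] -/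
theorem abs_norm_sub_one_le {v₀ u : E} {l₀ : ℂ} (hl₀ : ‖l₀‖ = 1) (hv₀ : ‖v₀‖ = 1) {ε₀ : ℝ}
    (h₀ : ‖v₀ - l₀ • u‖ ≤ ε₀) : |‖u‖ - 1| ≤ ε₀ := by
  have h1 : |‖l₀ • u‖ - ‖v₀‖| ≤ ‖l₀ • u - v₀‖ := abs_norm_sub_norm_le _ _
  rw [norm_smul, hl₀, one_mul, hv₀, norm_sub_rev] at h1
  exact h1.trans h₀

/-- **Two unit vectors close to `λ₀ u`, `λ₁ u` are close to `λ₀ ψ`, `λ₁ ψ` for a UNIT vector `ψ`.**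
[folklore] -/
theorem exists_unit_common {v₀ v₁ u : E} {l₀ l₁ : ℂ} (hl₀ : ‖l₀‖ = 1) (hl₁ : ‖l₁‖ = 1) (hv₀ : ‖v₀‖ = 1)
    {ε₀ ε₁ : ℝ} (h₀ : ‖v₀ - l₀ • u‖ ≤ ε₀) (h₁ : ‖v₁ - l₁ • u‖ ≤ ε₁) (hε₀ : ε₀ < 1) :
    ∃ ψ : E, ‖ψ‖ = 1 ∧ ‖v₀ - l₀ • ψ‖ ≤ ε₀ + ε₀ ∧ ‖v₁ - l₁ • ψ‖ ≤ ε₁ + ε₀ := by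
  have hu1 : |‖u‖ - 1| ≤ ε₀ := abs_norm_sub_one_le hl₀ hv₀ h₀
  have hu0 : u ≠ 0 := by
    intro h
    rw [h, norm_zero, zero_sub, abs_neg, abs_one] at hu1
    linarith
  have hun : ‖u‖ ≠ 0 := norm_ne_zero_iff.2 hu0
  set ψ : E := ((‖u‖⁻¹ : ℝ) : ℂ) • u with hψ
  have hψn : ‖ψ‖ = 1 := by
    rw [hψ, norm_smul, Complex.norm_real, Real.norm_of_nonneg (inv_nonneg.2 (norm_nonneg _)), inv_mul_cancel₀ hun]
  have hdiff : ‖u - ψ‖ ≤ ε₀ := by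
    have e : u - ψ = ((1 - ‖u‖⁻¹ : ℝ) : ℂ) • u := by
      rw [hψ, Complex.ofReal_sub, Complex.ofReal_one, sub_smul, one_smul]
    rw [e, norm_smul, Complex.norm_real, Real.norm_eq_abs]
    have : |1 - ‖u‖⁻¹| * ‖u‖ = |‖u‖ - 1| := by
      rw [← abs_of_nonneg (norm_nonneg u), ← abs_mul, abs_of_nonneg (norm_nonneg u), sub_mul, one_mul,
        inv_mul_cancel₀ hun]
    rw [this]; exact hu1
  refine ⟨ψ, hψn, ?_, ?_⟩
  · calc ‖v₀ - l₀ • ψ‖ = ‖(v₀ - l₀ • u) + l₀ • (u - ψ)‖ := by rw [smul_sub, sub_add_sub_cancel]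
      _ ≤ ‖v₀ - l₀ • u‖ + ‖l₀ • (u - ψ)‖ := norm_add_le _ _
      _ ≤ ε₀ + ε₀ := add_le_add h₀ (by rw [norm_smul, hl₀, one_mul]; exact hdiff)
  · calc ‖v₁ - l₁ • ψ‖ = ‖(v₁ - l₁ • u) + l₁ • (u - ψ)‖ := by rw [smul_sub, sub_add_sub_cancel]
      _ ≤ ‖v₁ - l₁ • u‖ + ‖l₁ • (u - ψ)‖ := norm_add_le _ _
      _ ≤ ε₁ + ε₀ := add_le_add h₁ (by rw [norm_smul, hl₁, one_mul]; exact hdiff)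

/-- `Re(e^{iα} · conj e^{iβ}) = cos(α − β)`. [folklore] -/
theorem re_exp_mul_conj_exp (α β : ℝ) :
    (Complex.exp (α * I) * (starRingEnd ℂ) (Complex.exp (β * I))).re = Real.cos (α - β) := by
  rw [← Complex.exp_conj, map_mul, Complex.conj_ofReal, Complex.conj_I, mul_neg, ← Complex.exp_add,
    show (α : ℂ) * I + -(β * I) = ((α - β : ℝ) : ℂ) * I by push_cast; ring, Complex.exp_ofReal_mul_I_re]

/-- The trivial bound: for unit vectors the interference probability and its target lie in `[0, 1]`,
so their distance is at most `δ(2 + δ)` as soon as `δ ≥ 1`. [folklore] -/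
theorem abs_sub_le_of_one_le {a b δ : ℝ} (ha0 : 0 ≤ a) (ha1 : a ≤ 1) (hb0 : 0 ≤ b) (hb1 : b ≤ 1) (hδ : 1 ≤ δ) :
    |a - b| ≤ δ * (2 + δ) := by
  have h : |a - b| ≤ 1 := by rw [abs_le]; constructor <;> linarith
  nlinarith

/-- `‖(1/2)(v₀ + w)‖² ≤ 1` for `‖v₀‖ = ‖w‖ = 1`. [folklore] -/
theorem norm_sq_half_add_le_one {v₀ w : E} (hv₀ : ‖v₀‖ = 1) (hw : ‖w‖ = 1) : ‖((1 : ℂ) / 2) • (v₀ + w)‖ ^ 2 ≤ 1 := by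
  have h : ‖((1 : ℂ) / 2) • (v₀ + w)‖ ≤ 1 := by
    rw [norm_smul]
    calc ‖((1 : ℂ) / 2)‖ * ‖v₀ + w‖ ≤ (1 / 2) * (1 + 1) := by
          apply mul_le_mul (by simp) ((norm_add_le _ _).trans (by rw [hv₀, hw])) (norm_nonneg _) (by norm_num)
      _ = 1 := by norm_num
  nlinarith [norm_nonneg (((1 : ℂ) / 2) • (v₀ + w))]

/-- `|Re z| ≤ 1` for `|z| = 1`-products. [folklore] -/
theorem abs_re_mul_conj_le {l₀ l₁ : ℂ} (hl₀ : ‖l₀‖ = 1) (hl₁ : ‖l₁‖ = 1) : |(l₀ * (starRingEnd ℂ) l₁).re| ≤ 1 :=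
  (Complex.abs_re_le_norm _).trans (by rw [norm_mul, Complex.norm_conj, hl₀, hl₁, one_mul])

/-- **The cosine copies** [VanDamSeroussi2002, §3.1 Fact 2, robust]: unit vectors `v₀, v₁` within
`ε₀, ε₁` of `λ₀ u, λ₁ u` (`|λ₀| = |λ₁| = 1`) interfere, after a Hadamard on the control, with
`|P(0) − (1 + Re(λ₀ λ̄₁))/2| ≤ δ(2 + δ)`, `δ = (3ε₀ + ε₁)/2`. [cite: VanDamSeroussi2002, §3.1 Fact 2 and §4 Thm. 1 (proof)] -/
theorem abs_probRe_sub_le {v₀ v₁ u : E} {l₀ l₁ : ℂ} (hl₀ : ‖l₀‖ = 1) (hl₁ : ‖l₁‖ = 1) (hv₀ : ‖v₀‖ = 1)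
    (hv₁ : ‖v₁‖ = 1) {ε₀ ε₁ : ℝ} (h₀ : ‖v₀ - l₀ • u‖ ≤ ε₀) (h₁ : ‖v₁ - l₁ • u‖ ≤ ε₁) :
    |‖((1 : ℂ) / 2) • (v₀ + v₁)‖ ^ 2 - (1 + (l₀ * (starRingEnd ℂ) l₁).re) / 2| ≤
      (3 * ε₀ + ε₁) / 2 * (2 + (3 * ε₀ + ε₁) / 2) := by
  have hε₀ : 0 ≤ ε₀ := (norm_nonneg _).trans h₀
  have hε₁ : 0 ≤ ε₁ := (norm_nonneg _).trans h₁
  by_cases hsmall : ε₀ < 1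
  · obtain ⟨ψ, hψ, hψ₀, hψ₁⟩ := exists_unit_common hl₀ hl₁ hv₀ h₀ h₁ hsmall
    -- the scalars as exponentials
    have e₀ : l₀ = Complex.exp ((arg l₀ : ℂ) * I) := eq_exp_arg_of_norm_eq_one hl₀
    have e₁ : l₁ = Complex.exp ((arg l₁ : ℂ) * I) := eq_exp_arg_of_norm_eq_one hl₁
    rw [e₀] at hψ₀
    rw [e₁] at hψ₁
    have key := abs_norm_sq_half_add_sub_le (arg l₀) (arg l₁) hψ hψ₀ hψ₁
    have hcos : Real.cos (arg l₀ - arg l₁) = (l₀ * (starRingEnd ℂ) l₁).re := by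
      rw [← re_exp_mul_conj_exp, ← e₀, ← e₁]
    rw [hcos] at key
    refine key.trans (le_of_eq ?_)
    ring
  · rw [not_lt] at hsmall
    have hδ : 1 ≤ (3 * ε₀ + ε₁) / 2 := by linarith
    refine abs_sub_le_of_one_le (sq_nonneg _) (norm_sq_half_add_le_one hv₀ hv₁) ?_ ?_ hδ
    · linarith [(abs_le.1 (abs_re_mul_conj_le hl₀ hl₁)).1]
    · linarith [(abs_le.1 (abs_re_mul_conj_le hl₀ hl₁)).2]

/-- **The sine copies**: with the phase gate `S = diag(1, i)` on the control before the Hadamard the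
second branch enters as `i v₁`, and `|P(0) − (1 + Im(λ₀ λ̄₁))/2| ≤ δ(2 + δ)`.
[cite: VanDamSeroussi2002, §4 Thm. 1 (proof: estimating γ from the sampled statistics)] -/
theorem abs_probIm_sub_le {v₀ v₁ u : E} {l₀ l₁ : ℂ} (hl₀ : ‖l₀‖ = 1) (hl₁ : ‖l₁‖ = 1) (hv₀ : ‖v₀‖ = 1)
    (hv₁ : ‖v₁‖ = 1) {ε₀ ε₁ : ℝ} (h₀ : ‖v₀ - l₀ • u‖ ≤ ε₀) (h₁ : ‖v₁ - l₁ • u‖ ≤ ε₁) :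
    |‖((1 : ℂ) / 2) • (v₀ + I • v₁)‖ ^ 2 - (1 + (l₀ * (starRingEnd ℂ) l₁).im) / 2| ≤
      (3 * ε₀ + ε₁) / 2 * (2 + (3 * ε₀ + ε₁) / 2) := by
  have hl₁' : ‖I * l₁‖ = 1 := by rw [norm_mul, Complex.norm_I, one_mul, hl₁]
  have hv₁' : ‖I • v₁‖ = 1 := by rw [norm_smul, Complex.norm_I, one_mul, hv₁]
  have h₁' : ‖I • v₁ - (I * l₁) • u‖ ≤ ε₁ := by
    rw [mul_smul, ← smul_sub, norm_smul, Complex.norm_I, one_mul]; exact h₁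
  have key := abs_probRe_sub_le hl₀ hl₁' hv₀ hv₁' h₀ h₁'
  have him : (l₀ * (starRingEnd ℂ) (I * l₁)).re = (l₀ * (starRingEnd ℂ) l₁).im := by
    rw [map_mul, Complex.conj_I]
    have : l₀ * (-I * (starRingEnd ℂ) l₁) = -I * (l₀ * (starRingEnd ℂ) l₁) := by ring
    rw [this, Complex.mul_re, Complex.neg_re, Complex.neg_im, Complex.I_re, Complex.I_im]
    ring
  rw [him] at key
  exact key

end Common

/-! ### The branch scalars -/

variable {p : ℕ} [hp : Fact p.Prime]

/-- `|G(χ, e)/√p| = 1` for a non-trivial character. [cite: VanDamSeroussi2002, §2.1 (|G| = √p) and §2.2 Def. 2] -/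
theorem norm_branchScalar {χ : MulChar (ZMod p) ℂ} (hχ : χ ≠ 1) :
    ‖gaussSum χ (ZMod.stdAddChar (N := p)) / (Real.sqrt p : ℂ)‖ = 1 := by
  have hs : (0 : ℝ) < Real.sqrt p := Real.sqrt_pos.2 (by exact_mod_cast hp.out.pos)
  rw [norm_div, norm_gaussSum_stdAddChar hχ, Complex.norm_real, Real.norm_of_nonneg hs.le, div_self hs.ne']

/-- **The reference scalar is Gauss's `ε_p`**: `G(η, e)/√p = ε_p ∈ {1, i}` for the quadratic character
`η` of an odd prime field. [cite: IrelandRosen1990, Ch. 6 §4 Thm. 1] [cite: VanDamSeroussi2002, §2.2 (quadratic Gauss sums are known)] -/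
theorem branchScalar_quadCharC (hp2 : p ≠ 2) :
    gaussSum (Literature.NumberTheory.EllipticCurves.ModularForms.quadCharC p) (ZMod.stdAddChar (N := p)) / (Real.sqrt p : ℂ) =
      Literature.NumberTheory.EllipticCurves.ModularForms.thetaEps p := by
  have h := gaussSum_quadCharC_mulShift_div_sqrt hp2 (1 : ZMod p)
  rw [AddChar.mulShift_one, map_one, one_mul] at h
  exact h

/-- `|ε_p| = 1`. [folklore] -/
theorem norm_thetaEps (d : ℤ) : ‖Literature.NumberTheory.EllipticCurves.ModularForms.thetaEps d‖ = 1 := by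
  unfold Literature.NumberTheory.EllipticCurves.ModularForms.thetaEps
  split_ifs
  · exact Complex.norm_I
  · exact norm_one

/-- **The twisted Gauss sum of the named fact through the branch scalar**:
`G(χ, e_b)/√p = χ⁻¹(b) · (G(χ, e)/√p)`. [cite: VanDamSeroussi2002, §2.1 Fact 1] -/
theorem gaussSum_mulShift_div_sqrt {χ : MulChar (ZMod p) ℂ} (hχ : χ ≠ 1) (b : ZMod p) :
    gaussSum χ (ZMod.stdAddChar.mulShift b) / (Real.sqrt p : ℂ) = χ⁻¹ b * (gaussSum χ ZMod.stdAddChar / (Real.sqrt p : ℂ)) := by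
  rw [gaussSum_mulShift_eq_inv_mul hχ, mul_div_assoc]

end VanDamSeroussi

end Literature.Computability.Cryptography

end
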